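import Summits.ResolutionOfSingularities.ResolutionOfSingularities.Theorems.FrobeniusClosingPatchingRelPerfectDepthLocalMonomialSumGame
import HarnessLib

/-!
# Crux `PatchingRelPerfect` (stmt-ResolutionOfSingularities-16161), chain W5.2 — F7(β): the END → T7β-M bridge for a LOCAL
# monomial-sum presentation («`K|_U = monomialSum 𝒦°`», members living on `U` only)

[OURS · L1 W5.2 · F7(β) X-side · res-L1-w52-plan-1 NAMING G10-6 (3) «`END` DEFINED AS THE GAME INPUT: `∃ U ⊇ cosupp K` open, a
sub-family `𝓕°` with `HasSNC (𝓕°|_U)` and `K|_U = monomialSum 𝒦°`» and Q9 G10-6 (4) «pointwise END ⇒ the U-presentation?».]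
Replaces the role of NO printed item; NOT a statement of the manuscript under review; fact-free, def-free.  AI-written; AI review is
weaker than expert review.

## Contents (namespace `…Theorems.DepthTargets`, next to res-type-003's T7β-M p539550)
* `monomialSumPrincipalization_of_comap_eq` — THE LOCAL FORM OF T7β-M: `X` regular Noetherian, `j : U ⟶ X` an open immersion from a
  Noetherian scheme, `K` an ideal sheaf of `X` cosupported in `j(U)`, and ON `U` a member family `Es` with simple normal crossings and
  exponent lists `𝒦 ≠ []` on `Es` with `K.comap j = monomialSum 𝒦` (the members need not extend to `X`: host-private divisors defined
  near the cosupport qualify) ⊢ a sequence of blowings up of `X` with regular centres over `cosupp K`, regular top, principalizing `K`.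
  Proof = res-type-003's `monomialSumPrincipalization_local` with the pull-back step deleted: play M2 (`monomialSumPrincipalization_holds`)
  on `U`, extend the centres (`CentreSeqExtend.exists_centreSeq_of_open`; `cosupp K` is closed in `X`).
* `monomialSumPrincipalization_of_comap_ι_eq` — the same for `j = U.ι`, `U : X.Opens` with `cosupp K ⊆ U`.
* `monomialSumPrincipalization_of_comap_eq_comap` — the intermediate currency «members on `X`, equality only on `U`»:
  `K.comap j = (monomialSum 𝒦).comap j` for lists `𝒦` on a family `Es` of `X` with `HasSNC (Es.map (·.comap j))`.
So the consumer side of Q9 is settled: a presentation of `K` as a monomial sum that holds only ON an open `U ⊇ cosupp K`, in members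
that are snc (and even defined) only on `U`, is enough for the X-side closure; «pointwise END ⇒ U-presentation» is the remaining half.

## References
* J. Kollár, *Lectures on Resolution of Singularities* (2007), (3.111) Step 3. [Kollar2007]
* U. Görtz, T. Wedhorn, *Algebraic Geometry I* (2nd ed., 2020), Prop. 13.91 (1)–(2). [GortzWedhorn2020]
* R. Goward, *A simple algorithm for principalization of monomial ideals*, Trans. AMS 357 (2005), §2. [Goward2005]
-/

-- `Summit.<Summit>.<Sub>.Theorems` with `Sub = Summit` (single-conjunct summit, D-0017)
set_option linter.dupNamespace false

noncomputable section

open CategoryTheory AlgebraicGeometry TopologicalSpace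
open Literature.AlgebraicGeometry.Resolution

namespace Summit.ResolutionOfSingularities.ResolutionOfSingularities.Theorems.DepthTargets

open CentreSeqExtend

universe u

/-- **T7β-M, LOCAL PRESENTATION FORM**: `X` regular Noetherian, `j : U ⟶ X` an open immersion from a Noetherian scheme, `K` an ideal
sheaf of `X` with `cosupp K ⊆ j(U)`, and on `U` a member family `Es` with simple normal crossings and exponent lists `𝒦 ≠ []` on `Es`
with `K|_U = monomialSum 𝒦`; then some sequence of blowings up of `X` with regular centres over `cosupp K`, with regular top, makes `K`
locally principal.  (Members living on `U` only.) [cite: Kollar2007, (3.111) Step 3] [cite: GortzWedhorn2020, Prop. 13.91 (1)–(2)]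
[cite: Goward2005, §2] -/
theorem monomialSumPrincipalization_of_comap_eq {X U : Scheme.{u}} [IsNoetherian X] [IsNoetherian U]
    (hX : Scheme.IsRegular X) (j : U ⟶ X) [IsOpenImmersion j] (K : X.IdealSheafData)
    (hsupp : (K.support : Set X) ⊆ Set.range j.base) (Es : List U.IdealSheafData) (hEs : HasSNC Es)
    (𝒦 : List (List (U.IdealSheafData × ℕ))) (h𝒦 : ∀ L ∈ 𝒦, boundaryOf L = Es) (hne : 𝒦 ≠ [])
    (hK : K.comap j = monomialSum 𝒦) :
    ∃ s : CentreSeq X, s.AllRegular ∧ s.CentresOver (K.support : Set X) ∧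
      Scheme.IsRegular s.top ∧ IsLocallyPrincipal (K.comap s.comp) := by
  -- M2 on `U`
  obtain ⟨s, hreg, hover, -, hlp⟩ := monomialSumPrincipalization_holds U
    (Scheme.IsRegular.of_isOpenImmersion j hX) Es hEs 𝒦 h𝒦 hne
  -- its centres lie over `j⁻¹ cosupp K`, a set CLOSED IN `X`
  have hover' : s.CentresOver (j.base ⁻¹' (K.support : Set X)) := by
    have h : ((monomialSum 𝒦).support : Set U) = j.base ⁻¹' (K.support : Set X) := by
      rw [← hK, Scheme.IdealSheafData.support_comap]
      rfl
    rw [← h]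
    exact hover
  -- extend to `X`
  obtain ⟨t, htreg, htover, httop, htlp⟩ := exists_centreSeq_of_open hX j K.support.isClosed hsupp s hreg hover'
  exact ⟨t, htreg, htover, httop, htlp K le_rfl (by rw [hK]; exact hlp)⟩

/-- **T7β-M, local presentation on an open `U : X.Opens`** (`j = U.ι`): `cosupp K ⊆ U`, members and exponent lists on `U`,
`K|_U = monomialSum 𝒦`. [cite: Kollar2007, (3.111) Step 3] [cite: GortzWedhorn2020, Prop. 13.91 (1)–(2)] -/
theorem monomialSumPrincipalization_of_comap_ι_eq {X : Scheme.{u}} [IsNoetherian X] (hX : Scheme.IsRegular X) (U : X.Opens)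
    (K : X.IdealSheafData) (hsupp : (K.support : Set X) ⊆ (U : Set X)) (Es : List (U : Scheme.{u}).IdealSheafData)
    (hEs : HasSNC Es) (𝒦 : List (List ((U : Scheme.{u}).IdealSheafData × ℕ))) (h𝒦 : ∀ L ∈ 𝒦, boundaryOf L = Es)
    (hne : 𝒦 ≠ []) (hK : K.comap U.ι = monomialSum 𝒦) :
    ∃ s : CentreSeq X, s.AllRegular ∧ s.CentresOver (K.support : Set X) ∧
      Scheme.IsRegular s.top ∧ IsLocallyPrincipal (K.comap s.comp) := by
  haveI : CompactSpace (U : Scheme.{u}) :=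
    isCompact_iff_compactSpace.mp (TopologicalSpace.NoetherianSpace.isCompact (U : Set X))
  haveI : IsNoetherian (U : Scheme.{u}) := ⟨⟩
  have hsupp' : (K.support : Set X) ⊆ Set.range U.ι.base := by
    rw [Scheme.Opens.range_ι]
    exact hsupp
  exact monomialSumPrincipalization_of_comap_eq hX U.ι K hsupp' Es hEs 𝒦 h𝒦 hne hK

/-- **T7β-M, intermediate currency** «members on `X`, equality only on `U`»: `Es` ideal sheaves of `X` with `HasSNC (Es.map (·|_U))`,
exponent lists `𝒦 ≠ []` on `Es`, `cosupp K ⊆ j(U)` and `K|_U = (monomialSum 𝒦)|_U`. [cite: Kollar2007, (3.111) Step 3]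
[cite: GortzWedhorn2020, Prop. 13.91 (1)–(2)] -/
theorem monomialSumPrincipalization_of_comap_eq_comap {X U : Scheme.{u}} [IsNoetherian X] [IsNoetherian U]
    (hX : Scheme.IsRegular X) (j : U ⟶ X) [IsOpenImmersion j] (K : X.IdealSheafData)
    (hsupp : (K.support : Set X) ⊆ Set.range j.base) (Es : List X.IdealSheafData) (hEs : HasSNC (Es.map (·.comap j)))
    (𝒦 : List (List (X.IdealSheafData × ℕ))) (h𝒦 : ∀ L ∈ 𝒦, boundaryOf L = Es) (hne : 𝒦 ≠ [])
    (hK : K.comap j = (monomialSum 𝒦).comap j) :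
    ∃ s : CentreSeq X, s.AllRegular ∧ s.CentresOver (K.support : Set X) ∧
      Scheme.IsRegular s.top ∧ IsLocallyPrincipal (K.comap s.comp) := by
  -- the pulled-back family on `U`
  set 𝒦' : List (List (U.IdealSheafData × ℕ)) := 𝒦.map fun A => A.map fun p => (p.1.comap j, p.2) with h𝒦'
  have hsum : (monomialSum 𝒦).comap j = monomialSum 𝒦' := comap_monomialSum_eq_map 𝒦 j
  have h𝒦'b : ∀ L ∈ 𝒦', boundaryOf L = Es.map (·.comap j) := by
    intro L hL
    obtain ⟨A, hA, rfl⟩ := List.mem_map.mp hL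
    rw [boundaryOf_map_comap, h𝒦 A hA]
  have hne' : 𝒦' ≠ [] := by
    rw [h𝒦']
    exact fun h => hne (List.map_eq_nil_iff.mp h)
  exact monomialSumPrincipalization_of_comap_eq hX j K hsupp (Es.map (·.comap j)) hEs 𝒦' h𝒦'b hne' (hK.trans hsum)

end Summit.ResolutionOfSingularities.ResolutionOfSingularities.Theorems.DepthTargets

end
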